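import Summits.Ventures.HodgeRepro2.T5SU11JacobiOrbitRadialLaw

/-!
# The radial density at `λ = 0` integrates to the Beta law: a cross-check of `T5SU11JacobiOrbitRadialLaw`
against `T5SU11OrbitRadiusLaw`

At `λ = 0` (`Φ_0 ≡ 1`) the radial density of `T5SU11JacobiOrbitRadialLaw` is `π (1 − t)^{k/2−2}/m̂_k(0)`
with `m̂_k(0) = 2π/(k − 2)`, and the elementary integral

  **`∫_y^1 (1 − t)^{k/2 − 2} dt = 2 (1 − y)^{(k−2)/2}/(k − 2)`**,  `k > 2`, `0 ≤ y < 1`   (`integral_Ioo_one_sub_rpow`)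

(`u = 1 − t` and `∫ u^r = u^{r+1}/(r+1)`, Mathlib's `integral_rpow`, convergent for `r = k/2 − 2 > −1`)
gives back **`P_{k,0}(|g·0|² > y) = (1 − y)^{(k−2)/2}`** (`orbit_sq_tail_prob_zero`) — the `Beta(1, (k−2)/2)` law
of `T5SU11OrbitRadiusLaw`, re-derived through the radial density: the two routes (the exponential law
of the phase there, the change of variables here) agree. Nothing is claimed about (N).

Blind lane: Mathlib + the HodgeRepro2 prefix only; no sorry; axioms ⊆ {propext, Classical.choice,
Quot.sound}.
-/

namespace Summit.Ventures.HodgeRepro2.T5SU11JacobiOrbitRadialCheck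

open MeasureTheory MeasureTheory.Measure Metric Set Filter Topology intervalIntegral
open T5SU11Unimodular T5SU11Fibration T5SU11Cartan T5HaarCircle T5BergmanCoefficient
  T5SU11FibrationHaar T5SU11SphericalFunction T5SU11SphericalSymmetry T5SU11SphericalBounds
  T5SU11SphericalContinuous T5SU11JacobiIwasawa T5SU11JacobiTransform T5SU11JacobiWeight
  T5SU11KFiniteMajorantPow T5SU11JacobiLaplacePhase T5SU11OrbitRadiusLaw T5SU11JacobiOrbitRadialLaw
open scoped Real

/-- **`∫_y^1 (1 − t)^{k/2 − 2} dt = 2 (1 − y)^{(k−2)/2}/(k − 2)`** for `k > 2` and `y ≤ 1`. -/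
theorem integral_Ioo_one_sub_rpow {k y : ℝ} (hk : 2 < k) (hy : y ≤ 1) :
    ∫ t in Ioo y 1, (1 - t) ^ (k / 2 - 2) = 2 * (1 - y) ^ ((k - 2) / 2) / (k - 2) := by
  rw [← integral_Ioc_eq_integral_Ioo, ← integral_of_le hy,
    show (fun t : ℝ => (1 - t) ^ (k / 2 - 2)) = fun t => (fun u : ℝ => u ^ (k / 2 - 2)) (1 - t) from rfl,
    integral_comp_sub_left (fun u : ℝ => u ^ (k / 2 - 2)) 1, sub_self,
    integral_rpow (Or.inl (by linarith)), show k / 2 - 2 + 1 = (k - 2) / 2 by ring]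
  have h0 : (0 : ℝ) ^ ((k - 2) / 2) = 0 := Real.zero_rpow (by intro h; linarith)
  rw [h0, sub_zero]
  have hk2 : k - 2 ≠ 0 := by linarith
  field_simp

section measure

variable [MeasurableSpace Circle] [BorelSpace Circle]

/-- **The Beta law re-derived**: for `k > 2` and `0 ≤ y < 1`, `P_{k,0}(|g·0|² > y) = (1 − y)^{(k−2)/2}`. -/
theorem orbit_sq_tail_prob_zero {k y : ℝ} (hk : 2 < k) (hy0 : 0 ≤ y) (hy1 : y < 1) :
    (∫ g in {g : SU11 | y < ‖orbit g‖ ^ 2}, (1 - ‖orbit g‖ ^ 2) ^ (k / 2) * sph 0 g ∂(nu haarCircle))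
        / ∫ g, (1 - ‖orbit g‖ ^ 2) ^ (k / 2) * sph 0 g ∂(nu haarCircle)
      = (1 - y) ^ ((k - 2) / 2) := by
  rw [orbit_sq_tail_prob_eq (by linarith) (by linarith) (by linarith) hy0 hy1]
  simp_rw [sphPhase_lam_zero, mul_one]
  rw [integral_Ioo_one_sub_rpow hk hy1.le, integral_orbit_rpow_mul_sph_zero hk]
  have hk2 : k - 2 ≠ 0 := by linarith
  have hpi : (2 * π : ℝ) ≠ 0 := by positivity
  field_simp

end measure

end Summit.Ventures.HodgeRepro2.T5SU11JacobiOrbitRadialCheck
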